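import Summits.BirchSwinnertonDyer.Rank1Residual.Additive.XMultRankZeroCyclotomicThree
import Summits.BirchSwinnertonDyer.Rank1Residual.Additive.ChiBranchConstantTermOdd
import Summits.BirchSwinnertonDyer.Rank1Residual.Additive.TwistRamTransport
import Literature.NumberTheory.EllipticCurves.Wuthrich2014.ReducibleNonsplitMultiplicativeDivisibilityCyclotomicThree
import Literature.NumberTheory.EllipticCurves.Wuthrich2014.SurjectiveNonsplitMultiplicativeDivisibilityCyclotomicThree
import Literature.NumberTheory.EllipticCurves.Greenberg1999.EulerCharacteristicNumberFieldMultiplicative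
import Literature.NumberTheory.EllipticCurves.PAdicLFunctionMinusMultDistributionProofs
import Literature.NumberTheory.EllipticCurves.PAdicLFunctionNonsplitMultiplicativeExistenceProofs
import Literature.NumberTheory.EllipticCurves.Rank1Residual.Typed.CasselsLowerBound
import HarnessLib

/-!
# X3/X4 (M)-rows at `p = 3`, `V` NON-SPLIT multiplicative: line V15 FROM NAMED FACTS ONLY
# (`K = ℚ(ζ₃)` instantiated; unit rows ⇒ `BSD(W,3) ∧ BSD(V,3)`)

HONEST FRAMING (cell `b2b-bsdres`, run/shared/lean/b2b/bsd-rank1-residual/, verbatim in every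
file): the goal of the cell is to DELETE the COMBINATION-SHAPED residual classes of the
Birch–Swinnerton-Dyer formula for ALL analytic-rank `≤ 1` elliptic curves over `ℚ` — "full BSD
formula for every rank `≤ 1` curve in class `C`" assembled STRICTLY from published theorems — so
that the rank-`≤ 1` remainder becomes exactly the CONSTRUCTION-SHAPED classes, which are TYPED
(missing-input `Prop`s), NOT attempted. This is not "finishing BSD". Seat additive-p4 (research route
on X3/X4), gen 6; the labels of X3/X4 are UNCHANGED by this file; nothing is booked here (referee).

Theorems only (no `def`, no `sorry`, no new named fact). The inline hypotheses of the core theorem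
`XMultCyclotomicThree.exists_padicVal_shaOrder_add_le` (`XMultRankZeroCyclotomicThree.lean`) are
DISCHARGED from named published facts and tree theorems:

* §1 `XMultCyclotomicThree.greenbergK_of_fact` — `hGrK` from Greenberg LNM 1716 pp. 112–113 ("the
  analogue of theorem 4.1", named fact `Greenberg1999.thm41Analogue_charValue_rankZero_numberField`) via
  the `K`-side data of `CyclotomicThreeMultiplicativeReduction` (`3` totally ramified, `𝔭 = (ζ₃ − 1)`,
  `N𝔭 = 3`, `V_K` NON-SPLIT multiplicative at `𝔭`);
* §2 `constantCoeff_padicLFunctionMinusBranchMult_half_of_nonsplit` — the odd branch at `T = 0`: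
  `L⁻_p(f, −1, ω^{(p−1)/2}, 0) = −∑_{a mod p}(a/p)[a/p]⁻_f` at a non-split prime (distribution law of the
  one-term measure, Euler's criterion for `ω`), i.e. `e⁻ = −1`; the even branch is THE function `L` with
  `IsMultPAdicLFunctionOf f 3 (−1) L` (exists: `exists_isMultPAdicLFunctionOf_neg_one_of_nonsplit`,
  x11c), `L(0) = 2[0]⁺_f`, i.e. `e⁺ = 2`;
* §3 X3: `XMultCyclotomicThree.exists_padicVal_shaOrder_add_le_of_facts_of_red` — `V[3]` REDUCIBLE,
  divisibility = Wuthrich 2014 Thm. 16 at a non-split multiplicative `3` over `ℚ(ζ₃)` (named fact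
  `Wuthrich2014.thm16_charIdeal_dvd_nonsplitMultiplicative_cyclotomicThree`); unit rows
  ⇒ `BSD(W,3) ∧ BSD(V,3)`; upper half; Cassels–Tate squeeze;
* X4 (`ρ_{V,3^∞}` onto, Kato's theorem as attributed by Wuthrich Thm. 3 / Cor. 19): sibling file
  `XMultRankZeroCyclotomicThreeX4Facts.lean` (same corollaries).

Published inputs, nothing else: the two Wuthrich reading-facts, Greenberg's display, Milne 1972
(Dokchitser–Dokchitser's model-free form, `hMilne`), modularity (`hmod`, `hmodD`),
Gross–Zagier–Kolyvagin (`hGZK`), (+ Cassels–Tate `hCT` for the certificate forms). Census (engine A,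
`N < 2·10⁴`; two-engine run requested from hyp): (M) ∧ `p = 3` ∧ `V` non-split ∧ ranks `(0,0)`:
X3 20 rows (19 doubly-unit), X4 208 rows (206 `surj(3)`, 204 with a `ram` prime, ≈196 doubly-unit), all
CORE-open. Labels UNCHANGED; nothing booked.
-/

noncomputable section

open scoped Classical MatrixGroups ModularForm

open CongruenceSubgroup WeierstrassCurve NumberField IsDedekindDomain
  Literature.NumberTheory.EllipticCurves Literature.NumberTheory.EllipticCurves.ModularForms
  Literature.NumberTheory.EllipticCurves.Rank1Residual
  Literature.NumberTheory.EllipticCurves.Rank1Residual.Typed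
  Literature.NumberTheory.GaloisRepresentations

namespace Summit.BirchSwinnertonDyer.Rank1Residual.Additive

/-! ## §1 `hGrK` from Greenberg's multiplicative analogue of Theorem 4.1 -/

section GreenbergK

variable (K : Type) [Field K] [NumberField K] [IsCyclotomicExtension {3} ℚ K]
  (V : WeierstrassCurve ℚ) [V.IsElliptic] [V.IsGloballyMinimal]

/-- **Greenberg's Euler characteristic for `V_K`, `K = ℚ(ζ₃)`, at the NON-SPLIT MULTIPLICATIVE prime
above `3`, in the `K`-shape of line V15** (the inline hypothesis `hGrK` of
`XMultCyclotomicThree.exists_padicVal_shaOrder_add_le`), DERIVED from the verbatim number-field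
statement `Greenberg1999.thm41Analogue_charValue_rankZero_numberField`: the only prime of `K` above `3`
is `𝔭 = (ζ₃ − 1)` (`N𝔭 = 3`) and `V_K` has non-split multiplicative reduction there
(`CyclotomicThreeMultiplicativeReduction`). [cite: GreenbergLNM1716, §4 pp. 112–113] -/
theorem XMultCyclotomicThree.greenbergK_of_fact
    (hGr : Greenberg1999.thm41Analogue_charValue_rankZero_numberField)
    (hmult : V.HasMultiplicativeReductionAtPrime 3) (hns : ¬ V.HasSplitMultiplicativeReductionAtPrime 3) :
    ∀ (κ : ZpExtension K 3) (γ : Field.absoluteGaloisGroup K),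
        κ.IsCyclotomic → κ.IsTopGenerator γ →
      ∀ (D : (V.baseChange K).SelmerDualData κ γ) [Module.Finite (IwasawaAlgebra 3) D.X], D.IsTorsion →
      ∀ (fE : IwasawaAlgebra 3), D.charIdeal = Ideal.span {fE} →
        Finite ((V.baseChange K).selmerGroupPInfty 3) →
        ∃ u : ℤ_[3]ˣ,
          ((PowerSeries.constantCoeff fE : ℤ_[3]) : ℚ_[3]) *
              (Nat.card (AddCommGroup.primaryComponent (V.baseChange K).toAffine.Point 3) : ℚ_[3]) ^ 2 =
            ((u : ℤ_[3]) : ℚ_[3]) * (3 : ℚ_[3]) ^ (padicValNat 3 (V.baseChange K).tamagawaProduct) *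
              (Nat.card ((V.baseChange K).selmerGroupPInfty 3) : ℚ_[3]) := by
  intro κ γ hκ hγ D _ hX fE hfE hfin
  haveI : (V.baseChange K).IsElliptic := by rw [baseChange]; infer_instance
  obtain ⟨𝔭, h3, hS, hN⟩ := exists_prime_over_three K
  have hmultK : (V.baseChange K).HasMultiplicativeReductionAt 𝔭 :=
    (isMinimalAt_and_hasMultiplicativeReductionAt_baseChange_of_mult V (p := 3) hmult 𝔭 h3).2
  have hnsK : ¬ (V.baseChange K).HasSplitMultiplicativeReductionAt 𝔭 :=
    not_hasSplitMultiplicativeReductionAt_baseChange_of_not_split V 𝔭 h3 hN hmult hns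
  obtain ⟨u, hu⟩ := hGr.of_unique_prime_nonsplit (V.baseChange K) 3 (by norm_num) 𝔭 hS hmultK hnsK κ γ
    hκ hγ D hX fE hfE hfin
  exact ⟨u, by rw [hu, Nat.cast_ofNat]⟩

end GreenbergK

/-! ## §2 The two tame branches at `T = 0` at a non-split multiplicative prime -/

section ConstantTerms

variable (p : ℕ) [hp : Fact p.Prime]

/-- **The ODD `χ_p`-branch of the one-term measure at `T = 0` (PROVED), non-split prime.** For
`p ≠ 2`, `V/ℚ` globally minimal with NON-split multiplicative reduction at `p` (`a_p = −1`) and `f` its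
newform: `constantCoeff (padicLFunctionMinusBranchMult f (−1) ((p−1)/2)) = −∑_{a mod p} (a/p)·[a/p]⁻_f`
(`= a_p⁻¹ · legendreMinusSymbolSum f p`). Proof: the constant term is `∑_{a ∈ (ℤ/p)ˣ} μ⁻(a + pℤ_p) ω(a)^{(p−1)/2}`
(`constantCoeff_padicLFunctionMinusBranchMult_eq` with the distribution law
`sum_fiber_msdMinusMeasureMult_succ_eq_of_coeffField`, `a_p(f) = −1`, `p ∣ N`);
`μ⁻(a + pℤ_p) = (−1)⁻¹[a/p]⁻`; `ω(a)^{(p−1)/2} = (a/p)` (Euler's criterion, tree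
`teichRep_pow_half_eq_legendreSym`). [cite: MazurTateTeitelbaum1986Invent, §I.10, §I.13–I.14] -/
theorem constantCoeff_padicLFunctionMinusBranchMult_half_of_nonsplit (hp2 : p ≠ 2) {N : ℕ} [NeZero N]
    {f : CuspForm (Gamma0 N) 2} (V : WeierstrassCurve ℚ) [V.IsElliptic] [V.IsGloballyMinimal]
    (hmult : V.HasMultiplicativeReductionAtPrime p) (hns : ¬ V.HasSplitMultiplicativeReductionAtPrime p)
    (hf : IsNewformOf V f) :
    PowerSeries.constantCoeff (padicLFunctionMinusBranchMult f (-1 : ℚ_[p]) (p / 2)) =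
      -(legendreMinusSymbolSum f p : ℚ_[p]) := by
  classical
  obtain ⟨hap, hpN⟩ := hf.cuspCoeff_eq_neg_one_and_dvd_of_nonsplit hmult hns
  have hdist0 := sum_fiber_msdMinusMeasureMult_succ_eq_of_coeffField (p := p) hf.1 hf.coeffField_eq_bot
    hpN (ap := -1) (by rw [hap]; norm_num) (by norm_num)
  have hcast : ((-1 : ℤ) : ℚ_[p]) = -1 := by norm_num
  rw [hcast] at hdist0
  rw [constantCoeff_padicLFunctionMinusBranchMult_eq hdist0 (p / 2)]
  have hsummand : ∀ a : (ZMod (p ^ cyclotomicExponent p))ˣ,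
      msdMinusMeasureMult f (-1 : ℚ_[p]) (cyclotomicExponent p) (a : ZMod (p ^ cyclotomicExponent p)) *
          ((((teichRep p a : rootsOfUnity (torsionOrder p) ℤ_[p]) : ℤ_[p]ˣ) : ℤ_[p]) : ℚ_[p]) ^
            (p / 2) =
        -((((legendreSym p ((a : ZMod (p ^ cyclotomicExponent p)).val : ℤ)) : ℚ_[p]) *
            (ratMinusSymbol f (((a : ZMod (p ^ cyclotomicExponent p)).val : ℚ) / p) : ℚ_[p]))) := by
    intro a
    have hteich : ((((teichRep p a : rootsOfUnity (torsionOrder p) ℤ_[p]) : ℤ_[p]ˣ) : ℤ_[p]) :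
        ℚ_[p]) ^ (p / 2) =
        (legendreSym p ((a : ZMod (p ^ cyclotomicExponent p)).val : ℤ) : ℚ_[p]) := by
      rw [← PadicInt.coe_pow, teichRep_pow_half_eq_legendreSym p hp2 a, PadicInt.coe_intCast]
    have he : cyclotomicExponent p = 1 := cyclotomicExponent_eq_one p hp2
    have h1 : ((-1 : ℚ_[p]))⁻¹ ^ cyclotomicExponent p = -1 := by rw [he, inv_neg, inv_one, pow_one]
    have h2 : ((p : ℚ)) ^ cyclotomicExponent p = p := by rw [he, pow_one]
    rw [hteich, msdMinusMeasureMult, h1, h2]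
    ring
  rw [Fintype.sum_congr _ _ hsummand]
  rw [sum_units_cyclotomicExponent_eq p hp2
    (fun n : ℕ ↦ -((legendreSym p (n : ℤ) : ℚ_[p]) * (ratMinusSymbol f ((n : ℚ) / p) : ℚ_[p])))
    (fun n hn ↦ by
      rw [(legendreSym.eq_zero_iff p (n : ℤ)).mpr (by exact_mod_cast (ZMod.natCast_eq_zero_iff n p).mpr hn)]
      push_cast
      ring)]
  rw [legendreMinusSymbolSum_def, Finset.sum_neg_distrib]
  push_cast
  rfl

/-- **At `p = 3`**: `constantCoeff (padicLFunctionMinusBranchMult f (−1) 1) = e⁻ · legendreMinusSymbolSum f 3`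
with the `3`-adic unit `e⁻ = −1` — the hypothesis `hLm0` of the core theorem, for the newform of a
curve with non-split multiplicative reduction at `3`. [cite: MazurTateTeitelbaum1986Invent, §I.13–I.14] -/
theorem constantCoeff_padicLFunctionMinusBranchMult_one_three_of_nonsplit {N : ℕ} [NeZero N]
    {f : CuspForm (Gamma0 N) 2} (V : WeierstrassCurve ℚ) [V.IsElliptic] [V.IsGloballyMinimal]
    (hmult : V.HasMultiplicativeReductionAtPrime 3) (hns : ¬ V.HasSplitMultiplicativeReductionAtPrime 3)
    (hf : IsNewformOf V f) :
    PowerSeries.constantCoeff (padicLFunctionMinusBranchMult f (-1 : ℚ_[3]) 1) =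
      (((-1 : ℤ_[3]ˣ) : ℤ_[3]) : ℚ_[3]) * (legendreMinusSymbolSum f 3 : ℚ_[3]) := by
  have h := constantCoeff_padicLFunctionMinusBranchMult_half_of_nonsplit 3 (by norm_num) V hmult hns hf
  rw [show (3 : ℕ) / 2 = 1 from rfl] at h
  rw [h]
  push_cast
  ring

/-- **The EVEN branch at `T = 0`, non-split prime**: `L(0) = e⁺ · [0]⁺_f` with the `3`-adic unit
`e⁺ = 2 = 1 − α⁻¹` for THE function `L` with `IsMultPAdicLFunctionOf f 3 (−1) L` (tree
`IsMultPAdicLFunctionOf.constantCoeff_of_neg_one`) — the hypothesis `hLp0` of the core theorem.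
[cite: GreenbergLNM1716, §4 (PDF p. 113)] -/
theorem exists_unit_constantCoeff_of_isMultPAdicLFunctionOf_neg_one {N : ℕ} {f : CuspForm (Gamma0 N) 2}
    {L : PowerSeries ℚ_[3]} (hL : IsMultPAdicLFunctionOf f 3 (-1) L) :
    ∃ e : ℤ_[3]ˣ, ((e : ℤ_[3]) : ℚ_[3]) = 2 ∧
      PowerSeries.constantCoeff L = ((e : ℤ_[3]) : ℚ_[3]) * (ratPlusSymbol f 0 : ℚ_[3]) := by
  have hnorm : ‖((2 : ℤ) : ℤ_[3])‖ = 1 := by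
    refine le_antisymm (PadicInt.norm_le_one _) (not_lt.mp ?_)
    rw [PadicInt.norm_int_lt_one_iff_dvd]
    norm_num
  have h2 : IsUnit ((2 : ℤ) : ℤ_[3]) := PadicInt.isUnit_iff.mpr hnorm
  refine ⟨h2.unit, ?_, ?_⟩
  · rw [h2.unit_spec]; push_cast; rfl
  · rw [hL.constantCoeff_of_neg_one, h2.unit_spec]; push_cast; rfl

end ConstantTerms

/-! ## §3 X3: `V[3]` reducible — Wuthrich Thm. 16 at the non-split multiplicative prime, over `ℚ(ζ₃)` -/

section X3Facts

variable (V : WeierstrassCurve ℚ) [V.IsElliptic] [V.IsGloballyMinimal]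
  (W : WeierstrassCurve ℚ) [W.IsElliptic] [W.IsGloballyMinimal]

/-- **Line V15 (X3 (M)-rows, `p = 3`), core inequality, from named facts only.** Let `V/ℚ` be
globally minimal with NON-SPLIT multiplicative reduction at `3` and `V[3]` REDUCIBLE, and
`W = C • V^{(−3)}` a globally minimal model of its twist by `−3`, ADDITIVE at `3` (the X3 ∧ (M)
situation at `p = 3`, Kodaira `I_n*`), both of analytic rank `0`. Then `#Ш_an(V) = q_V`,
`#Ш_an(W) = q_W` are rationals with **`ord₃ #Ш(V) + ord₃ #Ш(W) ≤ ord₃ q_V + ord₃ q_W`**, granted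
EXACTLY: Wuthrich 2014 Thm. 16 (non-split multiplicative `3`, over `ℚ(ζ₃)`; named fact `hW16`),
Greenberg LNM 1716 pp. 112–113 (named fact `hGr`), Milne 1972 (`hMilne`), modularity (`hmod`,
`hmodD`), Gross–Zagier–Kolyvagin (`hGZK`). `K` is instantiated as `CyclotomicField 3 ℚ`; the newform,
the period ratios `ϖ, ϖ'`, the even branch (`exists_isMultPAdicLFunctionOf_neg_one_of_nonsplit`) and
both constant terms are THEOREMS. [cite: Wuthrich2014, Thm. 16 (p. 397)] [cite: GreenbergLNM1716, §4 pp. 112–113]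
[cite: Milne1972ArithmeticAV, §1 Thm. 1] -/
theorem XMultCyclotomicThree.exists_padicVal_shaOrder_add_le_of_facts_of_red
    (hW16 : Wuthrich2014.thm16_charIdeal_dvd_nonsplitMultiplicative_cyclotomicThree)
    (hGr : Greenberg1999.thm41Analogue_charValue_rankZero_numberField)
    (hMilne : Milne1972.bsdQuotient_baseChange_quadratic_anyModel)
    (hGZK : rank_eq_analyticRank_of_analyticRank_le_one) (hmod : hasEntireLFunction_rat)
    (hmodD : nonempty_modularParametrizationData)
    (C : VariableChange ℚ) (hC : C • V.quadraticTwist (-(3 : ℚ)) = W)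
    (hmult : V.HasMultiplicativeReductionAtPrime 3) (hns : ¬ V.HasSplitMultiplicativeReductionAtPrime 3)
    (hred : ¬ V.HasIrreducibleModPGaloisRep 3) (hadd : Addv W 3)
    (hrV : V.analyticRank = 0) (hrW : W.analyticRank = 0) :
    ∃ qV qW : ℚ, shaAn V = (qV : ℂ) ∧ shaAn W = (qW : ℂ) ∧
      (padicValNat 3 V.shaOrder : ℤ) + padicValNat 3 W.shaOrder ≤ padicValRat 3 qV + padicValRat 3 qW := by
  haveI : IsCyclotomicExtension {3} ℚ (CyclotomicField 3 ℚ) := CyclotomicField.isCyclotomicExtension 3 ℚ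
  set K := CyclotomicField 3 ℚ
  -- the newform and the two rational period ratios
  haveI : NeZero (V.conductorNorm ℤ) := ⟨(V.conductorNorm_pos_holds).ne'⟩
  obtain ⟨Dm⟩ := hmodD V
  have hf : IsNewformOf V Dm.f := Dm.isNewformOf
  obtain ⟨ϖ, -, hϖ, -⟩ := Dm.exists_rat_mul_realPeriodRat_eq_plusPeriod
  obtain ⟨ϖ', -, hϖ'⟩ := exists_rat_mul_imaginaryPeriodRat_eq_minusPeriod Dm
  -- the even branch and the two constant terms
  obtain ⟨Lp, hLp⟩ := exists_isMultPAdicLFunctionOf_neg_one_of_nonsplit hf hmult hns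
  obtain ⟨ep, -, hLp0⟩ := exists_unit_constantCoeff_of_isMultPAdicLFunctionOf_neg_one hLp
  have hLm0 := constantCoeff_padicLFunctionMinusBranchMult_one_three_of_nonsplit V hmult hns hf
  refine XMultCyclotomicThree.exists_padicVal_shaOrder_add_le K V W hGZK hmod hMilne C hC hmult hadd hrV
    hrW hf ϖ ϖ' hϖ hϖ' Lp (padicLFunctionMinusBranchMult Dm.f (-1 : ℚ_[3]) 1) ep (-1) hLp0 hLm0
    (fun κ γ hκ hγ hγ' D ↦ ?_) (XMultCyclotomicThree.greenbergK_of_fact K V hGr hmult hns)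
  exact hW16 V K (V.baseChange K) hmult hns hred ⟨1, one_smul _ _⟩ hκ hγ hγ' hf D ϖ ϖ' hϖ hϖ' Lp hLp

/-- **The cell's typed UPPER half for the additive X3 (M)-curve, from named facts only**: in the
situation of `…_of_facts_of_red`, if `#Ш_an(V)` has non-positive `3`-adic valuation (census bit
`3 ∤ #Ш_an(V)` of the twist pair) then `ord₃ #Ш(W) ≤ ord₃ #Ш_an(W)`, i.e. `Typed.MissingUpperBoundAt W 3`.
[cite: Wuthrich2014, Thm. 16 (p. 397)] [cite: GreenbergLNM1716, §4 pp. 112–113] -/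
theorem XMultCyclotomicThree.missingUpperBoundAt_of_facts_of_red
    (hW16 : Wuthrich2014.thm16_charIdeal_dvd_nonsplitMultiplicative_cyclotomicThree)
    (hGr : Greenberg1999.thm41Analogue_charValue_rankZero_numberField)
    (hMilne : Milne1972.bsdQuotient_baseChange_quadratic_anyModel)
    (hGZK : rank_eq_analyticRank_of_analyticRank_le_one) (hmod : hasEntireLFunction_rat)
    (hmodD : nonempty_modularParametrizationData)
    (C : VariableChange ℚ) (hC : C • V.quadraticTwist (-(3 : ℚ)) = W)
    (hmult : V.HasMultiplicativeReductionAtPrime 3) (hns : ¬ V.HasSplitMultiplicativeReductionAtPrime 3)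
    (hred : ¬ V.HasIrreducibleModPGaloisRep 3) (hadd : Addv W 3)
    (hrV : V.analyticRank = 0) (hrW : W.analyticRank = 0)
    {qV : ℚ} (hqV : shaAn V = (qV : ℂ)) (hv : padicValRat 3 qV ≤ 0) :
    MissingUpperBoundAt W 3 := by
  obtain ⟨qV', qW, hqV', hqW, hle⟩ := XMultCyclotomicThree.exists_padicVal_shaOrder_add_le_of_facts_of_red
    V W hW16 hGr hMilne hGZK hmod hmodD C hC hmult hns hred hadd hrV hrW
  have hqq : qV' = qV := by exact_mod_cast hqV'.symm.trans hqV
  subst hqq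
  refine ⟨qW, hqW, ?_⟩
  have h0 : (0 : ℤ) ≤ padicValNat 3 V.shaOrder := by positivity
  linarith

/-- **`BSD(W,3) ∧ BSD(V,3)` on the doubly-unit X3 (M)-rows, from named facts only**: in the situation
of `…_of_facts_of_red`, if `#Ш_an(V)` and `#Ш_an(W)` are `3`-adic units then Miller's `BSD(W,3)` and
`BSD(V,3)` hold — for the ADDITIVE X3 pair `(W,3)` (type `I_n*`, `W[3]` reducible, `v₃(j) < 0`) and its
non-split multiplicative Eisenstein twist pair `(V,3)` (an X2-type pair) simultaneously. Census (engine
A, `N < 2·10⁴`): 19 of the 20 CORE-open rank-`(0,0)` X3 ∧ (M) ∧ non-split rows at `p = 3` are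
doubly-unit. Labels UNCHANGED; nothing booked by this theorem.
[cite: Wuthrich2014, Thm. 16 (p. 397)] [cite: GreenbergLNM1716, §4 pp. 112–113]
[cite: Milne1972ArithmeticAV, §1 Thm. 1] -/
theorem XMultCyclotomicThree.bsdp_of_shaAn_units_of_facts_of_red
    (hW16 : Wuthrich2014.thm16_charIdeal_dvd_nonsplitMultiplicative_cyclotomicThree)
    (hGr : Greenberg1999.thm41Analogue_charValue_rankZero_numberField)
    (hMilne : Milne1972.bsdQuotient_baseChange_quadratic_anyModel)
    (hGZK : rank_eq_analyticRank_of_analyticRank_le_one) (hmod : hasEntireLFunction_rat)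
    (hmodD : nonempty_modularParametrizationData)
    (C : VariableChange ℚ) (hC : C • V.quadraticTwist (-(3 : ℚ)) = W)
    (hmult : V.HasMultiplicativeReductionAtPrime 3) (hns : ¬ V.HasSplitMultiplicativeReductionAtPrime 3)
    (hred : ¬ V.HasIrreducibleModPGaloisRep 3) (hadd : Addv W 3)
    (hrV : V.analyticRank = 0) (hrW : W.analyticRank = 0)
    {qV qW : ℚ} (hqV : shaAn V = (qV : ℂ)) (hqW : shaAn W = (qW : ℂ))
    (hvV : padicValRat 3 qV = 0) (hvW : padicValRat 3 qW = 0) : BSDp W 3 ∧ BSDp V 3 := by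
  obtain ⟨qV', qW', hqV', hqW', hle⟩ :=
    XMultCyclotomicThree.exists_padicVal_shaOrder_add_le_of_facts_of_red V W hW16 hGr hMilne hGZK hmod
      hmodD C hC hmult hns hred hadd hrV hrW
  have hqq : qV' = qV := by exact_mod_cast hqV'.symm.trans hqV
  have hqq' : qW' = qW := by exact_mod_cast hqW'.symm.trans hqW
  subst hqq hqq'
  rw [hvV, hvW, add_zero] at hle
  have hV0 : (0 : ℤ) ≤ padicValNat 3 V.shaOrder := by positivity
  have hW0 : (0 : ℤ) ≤ padicValNat 3 W.shaOrder := by positivity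
  have huW : MissingUpperBoundAt W 3 := ⟨qW', hqW', by rw [hvW]; linarith⟩
  have huV : MissingUpperBoundAt V 3 := ⟨qV', hqV', by rw [hvV]; linarith⟩
  exact ⟨bsdp_of_missingPPartAt W 3 hGZK (by rw [hrW]; exact zero_le_one)
      (missingPPartAt_of_upper_of_shaAn_unit W 3 huW hqW' hvW),
    bsdp_of_missingPPartAt V 3 hGZK (by rw [hrV]; exact zero_le_one)
      (missingPPartAt_of_upper_of_shaAn_unit V 3 huV hqV' hvV)⟩

/-- **The `3 ∣ #Ш_an(W)` rows (X3 ∧ (M) ∧ non-split): `BSD(W,3)` from ONE finite certificate, named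
facts otherwise.** If `#Ш_an(V)` is a `3`-adic unit, `#Ш_an(W) = q` with `ord₃ q ≤ 2k` and
`3^{2k−1} ∣ #Ш(W)` (for `k = 1`: `Ш(W)[3] ≠ 0`, a `3`-descent certificate), then `BSD(W,3)` (upper half
above + Cassels–Tate squareness `hCT`). Census: the only such rank-`(0,0)` row is 15138i1 (`V` = 5046i1).
[cite: Wuthrich2014, Thm. 16 (p. 397)] [cite: SilvermanAEC2009, Thm. X.4.14] [cite: Miller2011LMS, §1 and Def. 1.1] -/
theorem XMultCyclotomicThree.bsdp_of_casselsTate_of_pow_dvd_of_facts_of_red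
    (hW16 : Wuthrich2014.thm16_charIdeal_dvd_nonsplitMultiplicative_cyclotomicThree)
    (hGr : Greenberg1999.thm41Analogue_charValue_rankZero_numberField)
    (hMilne : Milne1972.bsdQuotient_baseChange_quadratic_anyModel)
    (hGZK : rank_eq_analyticRank_of_analyticRank_le_one) (hmod : hasEntireLFunction_rat)
    (hmodD : nonempty_modularParametrizationData) (hCT : exists_casselsTate_pairing (K := ℚ))
    (C : VariableChange ℚ) (hC : C • V.quadraticTwist (-(3 : ℚ)) = W)
    (hmult : V.HasMultiplicativeReductionAtPrime 3) (hns : ¬ V.HasSplitMultiplicativeReductionAtPrime 3)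
    (hred : ¬ V.HasIrreducibleModPGaloisRep 3) (hadd : Addv W 3)
    (hrV : V.analyticRank = 0) (hrW : W.analyticRank = 0)
    {qV : ℚ} (hqV : shaAn V = (qV : ℂ)) (hvV : padicValRat 3 qV ≤ 0)
    {q : ℚ} (hq : shaAn W = (q : ℂ)) {k : ℕ} (hv : padicValRat 3 q ≤ 2 * k)
    (hdvd : 3 ^ (2 * k - 1) ∣ W.shaOrder) : BSDp W 3 :=
  bsdp_of_missingPPartAt W 3 hGZK (by rw [hrW]; exact zero_le_one)
    (missingPPartAt_of_lower_of_upper W 3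
      (missingLowerBoundAt_of_casselsTate_of_pow_dvd W 3 hCT (hGZK W (by rw [hrW]; exact zero_le_one)).2
        hq hv hdvd)
      (XMultCyclotomicThree.missingUpperBoundAt_of_facts_of_red V W hW16 hGr hMilne hGZK hmod hmodD C hC
        hmult hns hred hadd hrV hrW hqV hvV))

end X3Facts

end Summit.BirchSwinnertonDyer.Rank1Residual.Additive

end
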